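import Literature.InformationTheory.Entropy.QuantumLeftoverHashToolkit
import HarnessLib

/-!
# Leftover hashing against quantum side information, II: hashed blocks, the two-universal
# collision bound (TSSR11 Lemma 5) and «collision ≤ guessing»

Second of three files (see `QuantumLeftoverHashToolkit.lean` for the design). Source read on the
page: [cite: TomamichelEtAl2010, eq. (11)–(14), Lemma 5 and its proof; Lemma 3 / eq. (7)–(8) for
the role of «collision entropy ≤ min-entropy»]. Everything here is PROVED; no named fact.

CONTENT. §4 the hashed cq state: its conditional operators
`ρ_E^{[f,z]} := Σ_{x : f x = z} ρ_E^{[x]}` (eq. (13)) are the tree's push-forward `cqMap f ρ z`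
(`ConditionalMinEntropyBounds`, Tomamichel §6.3 — REUSED, not re-declared),
`cqMarginal ρ = ρ_E = Σ_x ρ_E^{[x]}`; the centering identity
`Σ_z Q(A_z − |Z|⁻¹ρ_E) = Σ_z Q(A_z) − |Z|⁻¹ Q(ρ_E)` (last display of Lemma 4's proof) and the
collision expansion `Σ_z Q(A_z) = Σ_{x,x'} [f x' = f x] B_w(a_x, a_{x'})`. §5 averaging over a
TWO-UNIVERSAL key family in the tree's counting form
`#{k ∈ K : h_k x = h_k x'} · |Z| ≤ |K|` (`x ≠ x'`; the hypothesis shape of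
`Literature.Computability.Cryptography.LeftoverHash.leftoverHash_flat_of_universal` and of
`LeftoverHash.toeplitz_universal`): Lemma 5 with `δ = 1/|Z|`, i.e. after the centering
`E_k Σ_z Q(A^{[k,z]} − |Z|⁻¹ Σ_x a_x) ≤ Σ_x Q(a_x)` (`avg_sum_wform_centered_le`). §6 the step
«collision term ≤ guessing probability»: TSSR11 bound `Γ_C(ρ_XB|σ_B) ≤ 2^{-H_min(X|B)}` through an
optimised `σ_B` (Lemma 3, «one of the main technical contributions»); in the tree's
GUESSING-PROBABILITY form of `H_min(X|E)` for cq states (TSSR11 §1 eq. (3); `condMinEntropy ρ =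
−log₂ guessProb ρ`) the bound for the REGULARISED marginal `τ = ρ_E + η·1` is immediate: the
operators `M_x := τ^{-1/2} ρ^{[x]} τ^{-1/2}` form a sub-POVM (`Σ_x M_x = τ^{-1/2} ρ_E τ^{-1/2} ≤ 1`,
the «pretty good measurement»), so `Σ_x tr(ρ^{[x]} M_x)` is a guessing value `≤ p_guess(X|E)_ρ`
(`sum_wform_le_guessProb`, written in an eigenbasis `V` of `ρ_E`, weights `w_i = √(d_i + η)`).

HONEST FRAMING. Toolkit lemmas for an extractor theorem; bounds only; nothing here proves or
refutes any quantum-advantage claim.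
-/

namespace Literature.InformationTheory.Entropy

open Matrix
open scoped ComplexOrder MatrixOrder
open Literature.LinearAlgebra.Matrix.NearestPositiveSemidefinite (re_trace_mul_nonneg)

namespace QuantumLeftoverHash

variable {e : Type*} [Fintype e] [DecidableEq e]

/-! ### §4 Hashing a cq state: the blocks `ρ_E^{[f,z]}` and the collision bound (TSSR11 Lemma 5)

[cite: TomamichelEtAl2010, eq. (11)–(13)]: for a cq state `ρ_XE = Σ_x |x⟩⟨x| ⊗ ρ_E^{[x]}` and a hash
function `f`, the hashed cq state has conditional operators
`ρ_E^{[f,z]} := Σ_{x : f(x) = z} ρ_E^{[x]}` and marginal `ρ_E = Σ_x ρ_E^{[x]}`; the former is the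
tree's `cqMap f ρ z` BY NAME. -/

section Hashing

variable {X : Type*} [Fintype X] [DecidableEq X] {γ : Type*} [Fintype γ] [DecidableEq γ]

/-- The marginal `ρ_E = Σ_x ρ_E^{[x]}` of a cq state given by its conditional operators.
[cite: TomamichelEtAl2010, eq. (11)] -/
def cqMarginal (ρ : X → Matrix e e ℂ) : Matrix e e ℂ := ∑ x, ρ x

omit [Fintype e] [DecidableEq e] [DecidableEq X] in
/-- The hashed blocks partition the marginal: `Σ_z ρ_E^{[f,z]} = ρ_E`. [cite: TomamichelEtAl2010,
eq. (11)–(13)] -/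
theorem sum_cqMap (ρ : X → Matrix e e ℂ) (f : X → γ) :
    ∑ z, cqMap f ρ z = cqMarginal ρ := by
  rw [cqMarginal]
  exact Finset.sum_fiberwise Finset.univ f ρ

omit [DecidableEq X] in
/-- **Centering step** (the `− tr(ρ_B τ^{-1/2} ρ_B τ^{-1/2})/d_A` of [cite: TomamichelEtAl2010,
Lemma 4 (proof, last display)]): with `Q(T) := B_w(T, T)`, `s := Σ_x a_x` and `c := |γ|`,
`Σ_z Q(A_z − c⁻¹ s) = Σ_z Q(A_z) − c⁻¹ Q(s)` for the hashed blocks `A_z` of any family `a`. -/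
theorem sum_wform_centered [Nonempty γ] (w : e → ℝ) (a : X → Matrix e e ℂ) (f : X → γ) :
    ∑ z, wform w (cqMap f a z - (Fintype.card γ : ℂ)⁻¹ • cqMarginal a)
        (cqMap f a z - (Fintype.card γ : ℂ)⁻¹ • cqMarginal a) =
      ∑ z, wform w (cqMap f a z) (cqMap f a z) -
        (Fintype.card γ : ℝ)⁻¹ * wform w (cqMarginal a) (cqMarginal a) := by
  set c : ℝ := (Fintype.card γ : ℝ) with hc
  have hc0 : c ≠ 0 := by rw [hc]; exact_mod_cast Fintype.card_ne_zero
  have hcc : (Fintype.card γ : ℂ)⁻¹ = ((c⁻¹ : ℝ) : ℂ) := by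
    rw [hc, Complex.ofReal_inv, Complex.ofReal_natCast]
  rw [hcc]
  set s := cqMarginal a with hs
  have hexp : ∀ z,
      wform w (cqMap f a z - ((c⁻¹ : ℝ) : ℂ) • s) (cqMap f a z - ((c⁻¹ : ℝ) : ℂ) • s) =
        wform w (cqMap f a z) (cqMap f a z) - c⁻¹ * wform w (cqMap f a z) s
        - c⁻¹ * wform w s (cqMap f a z) + c⁻¹ * c⁻¹ * wform w s s := by
    intro z
    rw [wform_sub_left, wform_sub_right, wform_sub_right, wform_smul_right, wform_smul_left,
      wform_smul_left, wform_smul_right]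
    ring
  rw [Finset.sum_congr rfl fun z _ => hexp z, Finset.sum_add_distrib, Finset.sum_sub_distrib,
    Finset.sum_sub_distrib, ← Finset.mul_sum, ← Finset.mul_sum, ← wform_sum_left, ← wform_sum_right,
    sum_cqMap, Finset.sum_const, Finset.card_univ, nsmul_eq_mul, ← hc]
  field_simp
  ring

omit [DecidableEq X] in
/-- **Collision expansion**: `Σ_z Q(A_z) = Σ_x Σ_{x'} [f x' = f x] · B_w(a_x, a_{x'})` — the
`Σ_{x,x'} E_F[Σ_z δ_{F(x)=z} δ_{F(x')=z}] tr(ρ^{[x]} τ^{-1/2} ρ^{[x']} τ^{-1/2})` display of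
[cite: TomamichelEtAl2010, Lemma 5 (proof)] before averaging over the key. -/
theorem sum_wform_cqMap (w : e → ℝ) (a : X → Matrix e e ℂ) (f : X → γ) :
    ∑ z, wform w (cqMap f a z) (cqMap f a z) =
      ∑ x, ∑ x', if f x' = f x then wform w (a x) (a x') else 0 := by
  have h1 : ∀ z, wform w (cqMap f a z) (cqMap f a z) =
      ∑ x ∈ Finset.univ.filter (fun x => f x = z),
        ∑ x' ∈ Finset.univ.filter (fun x' => f x' = z), wform w (a x) (a x') :=
    fun z => wform_sum_sum _ w a
  have h2 : ∀ z, ∑ x ∈ Finset.univ.filter (fun x => f x = z),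
        ∑ x' ∈ Finset.univ.filter (fun x' => f x' = z), wform w (a x) (a x') =
      ∑ x ∈ Finset.univ.filter (fun x => f x = z),
        ∑ x' ∈ Finset.univ.filter (fun x' => f x' = f x), wform w (a x) (a x') :=
    fun z => Finset.sum_congr rfl fun x hx => by rw [(Finset.mem_filter.1 hx).2]
  simp only [h1, h2]
  rw [Finset.sum_fiberwise Finset.univ f
    (fun x => ∑ x' ∈ Finset.univ.filter (fun x' => f x' = f x), wform w (a x) (a x'))]
  exact Finset.sum_congr rfl fun x _ => Finset.sum_filter _ _

end Hashing

/-! ### §5 Averaging over a two-universal key (TSSR11 Lemma 5 with `δ = 1/|Z|`) -/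

section Keys

variable {X : Type*} [Fintype X] [DecidableEq X] {γ : Type*} [Fintype γ] [DecidableEq γ]
  {κ : Type*}

omit [Fintype e] [DecidableEq e] in
/-- `Σ_{k ∈ K} [p k] · b = #{k ∈ K : p k} · b` (plumbing for the key average `E_F[δ_{F(x)=F(x')}]`).
[cite: TomamichelEtAl2010, Lemma 5 (proof)] -/
theorem sum_ite_const_eq_card_mul (K : Finset κ) (p : κ → Prop) [DecidablePred p] (b : ℝ) :
    ∑ k ∈ K, (if p k then b else 0) = ((K.filter p).card : ℝ) * b := by
  rw [← Finset.sum_filter, Finset.sum_const, nsmul_eq_mul]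

omit [Fintype e] [DecidableEq e] in
/-- **Key averaging under two-universality** («the expectation value … is at most `δ` if `x ≠ x'`
and `1` otherwise … and the trace terms are positive», [cite: TomamichelEtAl2010, Lemma 5 (proof)]):
for non-negative `B` and a family with `#{k : h_k x = h_k x'}·|Z| ≤ |K|` (`x ≠ x'`),
`E_k Σ_{x,x'} [h_k x' = h_k x] B(x,x') ≤ Σ_x B(x,x) + |Z|⁻¹ Σ_{x,x'} B(x,x')`. -/
theorem avg_collision_le [Nonempty γ] {K : Finset κ} (hK : K.Nonempty) (h : κ → X → γ)
    (hU : ∀ x x', x ≠ x' → (K.filter fun k => h k x = h k x').card * Fintype.card γ ≤ K.card)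
    (B : X → X → ℝ) (hB : ∀ x x', 0 ≤ B x x') :
    (K.card : ℝ)⁻¹ * ∑ k ∈ K, ∑ x, ∑ x', (if h k x' = h k x then B x x' else 0) ≤
      ∑ x, B x x + (Fintype.card γ : ℝ)⁻¹ * ∑ x, ∑ x', B x x' := by
  have hKc : (0 : ℝ) < K.card := by exact_mod_cast hK.card_pos
  have hc : (0 : ℝ) < Fintype.card γ := by exact_mod_cast Fintype.card_pos
  -- move the key sum inside and evaluate it as a collision count
  rw [Finset.sum_comm, Finset.mul_sum]
  have hterm : ∀ x x', (K.card : ℝ)⁻¹ * ∑ k ∈ K, (if h k x' = h k x then B x x' else 0) ≤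
      (if x' = x then B x x else 0) + (Fintype.card γ : ℝ)⁻¹ * B x x' := by
    intro x x'
    rw [sum_ite_const_eq_card_mul]
    by_cases hxx : x' = x
    · subst hxx
      rw [if_pos rfl]
      have hle : ((K.filter fun k => h k x' = h k x').card : ℝ) ≤ K.card := by
        exact_mod_cast Finset.card_filter_le _ _
      have h1 : (K.card : ℝ)⁻¹ * (((K.filter fun k => h k x' = h k x').card : ℝ) * B x' x') ≤
          B x' x' := by
        rw [← mul_assoc]
        calc (K.card : ℝ)⁻¹ * ((K.filter fun k => h k x' = h k x').card : ℝ) * B x' x'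
            ≤ 1 * B x' x' := by
              refine mul_le_mul_of_nonneg_right ?_ (hB _ _)
              rw [inv_mul_le_iff₀ hKc, mul_one]; exact hle
          _ = B x' x' := one_mul _
      have h2 : 0 ≤ (Fintype.card γ : ℝ)⁻¹ * B x' x' := mul_nonneg (inv_nonneg.2 hc.le) (hB _ _)
      linarith
    · rw [if_neg hxx, zero_add, ← mul_assoc]
      refine mul_le_mul_of_nonneg_right ?_ (hB _ _)
      have hu := hU x' x hxx
      have hu' : ((K.filter fun k => h k x' = h k x).card : ℝ) * Fintype.card γ ≤ K.card := by
        exact_mod_cast hu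
      rw [inv_mul_le_iff₀ hKc, ← div_eq_mul_inv, le_div_iff₀ hc]
      exact hu'
  calc ∑ x, (K.card : ℝ)⁻¹ * ∑ k ∈ K, ∑ x', (if h k x' = h k x then B x x' else 0)
      = ∑ x, ∑ x', (K.card : ℝ)⁻¹ * ∑ k ∈ K, (if h k x' = h k x then B x x' else 0) := by
        refine Finset.sum_congr rfl fun x _ => ?_
        rw [Finset.sum_comm, Finset.mul_sum]
    _ ≤ ∑ x, ∑ x', ((if x' = x then B x x else 0) + (Fintype.card γ : ℝ)⁻¹ * B x x') :=
        Finset.sum_le_sum fun x _ => Finset.sum_le_sum fun x' _ => hterm x x'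
    _ = ∑ x, B x x + (Fintype.card γ : ℝ)⁻¹ * ∑ x, ∑ x', B x x' := by
        simp only [Finset.sum_add_distrib, Finset.sum_ite_eq', Finset.mem_univ, if_true,
          Finset.mul_sum]

/-- **TSSR11 Lemma 5 + the centering of Lemma 4, combined** (`δ = 1/|Z|`, `τ` diagonal in the
working basis): for positive semidefinite blocks `a_x`, a two-universal key family and
`Q = B_w(·,·)`,
`E_k Σ_z Q(A^{[k,z]} − |Z|⁻¹ Σ_x a_x) ≤ Σ_x Q(a_x)` — i.e.
`d_A Γ_C(ρ_{ZKE} | ρ_K ⊗ τ) − tr(ρ τ^{-1/2} ρ τ^{-1/2}) ≤ d_A Γ_C(ρ_XE | τ)` after the `|Z|`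
bookkeeping. [cite: TomamichelEtAl2010, Lemma 5 and eq. (14)] -/
theorem avg_sum_wform_centered_le [Nonempty γ] (w : e → ℝ) {K : Finset κ} (hK : K.Nonempty)
    (h : κ → X → γ)
    (hU : ∀ x x', x ≠ x' → (K.filter fun k => h k x = h k x').card * Fintype.card γ ≤ K.card)
    {a : X → Matrix e e ℂ} (ha : ∀ x, (a x).PosSemidef) :
    (K.card : ℝ)⁻¹ * ∑ k ∈ K, ∑ z,
        wform w (cqMap (h k) a z - (Fintype.card γ : ℂ)⁻¹ • cqMarginal a)
          (cqMap (h k) a z - (Fintype.card γ : ℂ)⁻¹ • cqMarginal a) ≤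
      ∑ x, wform w (a x) (a x) := by
  have hKc : (K.card : ℝ) ≠ 0 := by exact_mod_cast hK.card_pos.ne'
  simp only [sum_wform_centered, sum_wform_cqMap]
  rw [Finset.sum_sub_distrib, Finset.sum_const, nsmul_eq_mul, mul_sub, ← mul_assoc,
    inv_mul_cancel₀ hKc, one_mul]
  have hQs : wform w (cqMarginal a) (cqMarginal a) = ∑ x, ∑ x', wform w (a x) (a x') :=
    wform_sum_sum _ w a
  have havg := avg_collision_le hK h hU (fun x x' => wform w (a x) (a x'))
    (fun x x' => wform_nonneg_of_posSemidef w (ha x) (ha x'))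
  rw [hQs]
  linarith

end Keys

/-! ### §6 The collision term is a guessing value (pretty-good-measurement step)

[cite: TomamichelEtAl2010, Lemma 3 and eq. (8)] bound the conditional collision entropy by the
min-entropy via an optimised `σ_B`. In the tree's GUESSING-PROBABILITY form of `H_min(X|E)` for cq
states ([cite: TomamichelEtAl2010, §1 eq. (3)]; `condMinEntropy = −log₂ guessProb`) the same bound
for `τ = ρ_E` (regularised) is immediate and constructive: the operators
`M_x := τ_η^{-1/2} ρ^{[x]} τ_η^{-1/2}`, `τ_η := ρ_E + η·1`, form a sub-POVM
(`Σ_x M_x = τ_η^{-1/2} ρ_E τ_η^{-1/2} ≤ 1`), so `Γ = Σ_x tr(ρ^{[x]} M_x)` is the success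
probability of a guessing strategy (the «pretty good measurement»), hence `≤ p_guess(X|E)_ρ`.
Written in an eigenbasis `V` of `ρ_E` (`V* ρ_E V = diag(d)`), with weights `w_i = √(d_i + η)`. -/

section PGM

variable {X : Type*} [Fintype X] [DecidableEq X]

open Literature.Computability.Cryptography.Chen2024 (POVM)

/-- **Collision term ≤ guessing probability.** For a cq state `ρ` with `ρ_E = V·diag(d)·V*`
(`V` unitary, `d ≥ 0`) and `η > 0`, with `w_i := √(d_i + η)`:
`Σ_x B_w(V*ρ^{[x]}V, V*ρ^{[x]}V) ≤ p_guess(X|E)_ρ`, i.e. `Γ_C(ρ_XE | ρ_E + η) ≤ 2^{-H_min(X|E)_ρ}`.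
[cite: TomamichelEtAl2010, Lemma 3 eq. (7) (the role it plays in Theorem 6; proved here by the
pretty-good-measurement sub-POVM instead of the optimised `σ_B`)] -/
theorem sum_wform_le_guessProb [Nonempty X] {ρ : X → Matrix e e ℂ} (hρ : ∀ x, (ρ x).PosSemidef)
    {V : Matrix e e ℂ} (hV' : V * Vᴴ = 1) {d : e → ℝ} (hd : ∀ i, 0 ≤ d i)
    (hdiag : Vᴴ * cqMarginal ρ * V = diagonal fun i => (d i : ℂ)) {η : ℝ} (hη : 0 < η) :
    ∑ x, wform (fun i => Real.sqrt (d i + η)) (Vᴴ * ρ x * V) (Vᴴ * ρ x * V) ≤ guessProb ρ := by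
  set w : e → ℝ := fun i => Real.sqrt (d i + η) with hw
  set a : X → Matrix e e ℂ := fun x => Vᴴ * ρ x * V with ha
  have hapsd : ∀ x, (a x).PosSemidef := fun x => (hρ x).conjTranspose_mul_mul_same V
  have hdη : ∀ i, 0 < d i + η := fun i => add_pos_of_nonneg_of_pos (hd i) hη
  have hwsq : ∀ i, w i ^ 2 = d i + η := fun i => Real.sq_sqrt (hdη i).le
  -- the sub-POVM `M'_x := W a_x W` in the rotated frame and its defect `R := 1 − Σ_x M'_x`
  set W : Matrix e e ℂ := winv w with hW
  set M' : X → Matrix e e ℂ := fun x => W * a x * W with hM'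
  have hM'psd : ∀ x, (M' x).PosSemidef := fun x => by
    have h := (hapsd x).mul_mul_conjTranspose_same W
    rwa [hW, winv_conjTranspose, ← hW] at h
  set r : e → ℝ := fun i => η / (d i + η) with hr
  have hsumM' : ∑ x, M' x = diagonal fun i => ((d i / (d i + η) : ℝ) : ℂ) := by
    have h1 : ∑ x, M' x = W * (Vᴴ * cqMarginal ρ * V) * W := by
      simp only [hM', ha, cqMarginal, Finset.mul_sum, Finset.sum_mul]
    rw [h1, hdiag, hW, winv, diagonal_mul_diagonal, diagonal_mul_diagonal]
    congr 1
    funext i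
    rw [← Complex.ofReal_mul, ← Complex.ofReal_mul]
    congr 1
    rw [div_eq_mul_inv, ← hwsq i]
    ring
  have hR : 1 - ∑ x, M' x = diagonal fun i => ((r i : ℝ) : ℂ) := by
    rw [hsumM', ← diagonal_one, diagonal_sub]
    congr 1
    funext i
    rw [← Complex.ofReal_one, ← Complex.ofReal_sub]
    congr 1
    have hne : d i + η ≠ 0 := (hdη i).ne'
    simp only [hr]
    rw [eq_div_iff hne, sub_mul, div_mul_cancel₀ _ hne]
    ring
  have hRpsd : (1 - ∑ x, M' x).PosSemidef := by
    rw [hR]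
    exact PosSemidef.diagonal fun i => Complex.zero_le_real.2 (div_nonneg hη.le (hdη i).le)
  -- complete it to a POVM by adding the defect to the outcome `x₀`, and rotate back by `V`
  obtain ⟨x₀⟩ := ‹Nonempty X›
  set N : X → Matrix e e ℂ := fun x => M' x + if x = x₀ then 1 - ∑ y, M' y else 0 with hN
  have hNpsd : ∀ x, (N x).PosSemidef := fun x => by
    simp only [hN]
    split_ifs
    · exact (hM'psd x).add hRpsd
    · rw [add_zero]; exact hM'psd x
  have hNsum : ∑ x, N x = 1 := by
    simp only [hN, Finset.sum_add_distrib, Finset.sum_ite_eq', Finset.mem_univ, if_true]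
    abel
  let P : POVM e X :=
    { effect := fun x => V * N x * Vᴴ
      posSemidef := fun x => (hNpsd x).mul_mul_conjTranspose_same V
      sum_eq_one := by
        rw [← Finset.sum_mul, ← Finset.mul_sum, hNsum, Matrix.mul_one, hV'] }
  -- its guessing value dominates the collision term
  have hval : ∑ x, wform w (a x) (a x) ≤ guessValue ρ P := by
    rw [guessValue]
    refine Finset.sum_le_sum fun x _ => ?_
    -- `tr(ρ_x V N_x V*) = tr(a_x N_x)`
    have hcyc : (ρ x * (V * N x * Vᴴ)).trace = (a x * N x).trace := by
      rw [show ρ x * (V * N x * Vᴴ) = ρ x * V * N x * Vᴴ by simp only [Matrix.mul_assoc],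
        Matrix.trace_mul_cycle, show Vᴴ * (ρ x * V) * N x = a x * N x by
          simp only [ha, Matrix.mul_assoc]]
    change wform w (a x) (a x) ≤ ((ρ x * (V * N x * Vᴴ)).trace).re
    rw [hcyc]
    simp only [hN, Matrix.mul_add, trace_add, Complex.add_re]
    have hfirst : wform w (a x) (a x) = ((a x * M' x).trace).re := by
      rw [wform, (hapsd x).1.eq]
      simp only [hM', hW, Matrix.mul_assoc]
    have hsecond : 0 ≤ ((a x * if x = x₀ then 1 - ∑ y, M' y else 0).trace).re := by
      split_ifs
      · exact re_trace_mul_nonneg (hapsd x) hRpsd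
      · rw [Matrix.mul_zero, trace_zero, Complex.zero_re]
    linarith
  exact hval.trans (le_ciSup (bddAbove_range_guessValue hρ) P)

end PGM

end QuantumLeftoverHash

end Literature.InformationTheory.Entropy
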